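import Literature.NumberTheory.PAdicHodge.TateH1BdRFilOfTS1
import HarnessLib

/-!
# Scalar cochains `σ ↦ a(σ) · t` in `B_dR⁺(F)`: Fontaine-continuity is `p`-adic continuity of the coefficient

Topic `Literature/NumberTheory/PAdicHodge`; THEOREMS ONLY (no definition, no named fact, no instance, no `sorry`).
Sequel to `BdRPlusGaloisContinuity` and `TateH1BdRFilOfTS1` Part I (the def-free continuity predicate on cochains
`z : Γ_F → B_dR⁺(F)`: `∀ N k, ∃ U open, ∀ σ, ∀ τ ∈ U, z(στ) − z(σ) ∈ Λ(N, k) = p^N ι(𝔸_inf) + ξ^k B_dR⁺` — Fontaine,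
*Le corps des périodes p-adiques*, Exp. II §1.5; Kato, LNM 1553, II §1.2.5). For a `ℤ_p`-valued function
`a : Γ_F → ℤ_p` and Fontaine's `t = log[ε]` (`BdRPlusLog.tBdR`):

* ★ `continuous_of_uc_qpToBdR_mul_tBdR` — **if `σ ↦ a(σ) · t` is Fontaine-continuous then `a` is continuous** (division by `t`,
  `GaloisContinuity.uc_of_tBdR_mul`; the projection `θ` is continuous, `continuous_thetaBdR_of_uc`, and
  `θ(ℚ_p · 1) = ℚ_p ⊆ F ⊆ ℂ_F` carries the restriction of `F`'s absolute value, `thetaBdR_qpToBdR`,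
  `PadicBase.norm_ofPadicInt_le_pow_iff`: `‖d‖_{K₀} ≤ ‖p‖^N ↔ |d|_p ≤ p^{-N}`);
* `uc_qpToBdR_coe_mul_tBdR_of_continuous` — the converse (`uc_qpToBdR_mul` with the bounded constant cochain `t`);
* `uc_qpToBdR_coe_of_uc_mul_tBdR` — the intermediate step (`σ ↦ a(σ) · 1` is Fontaine-continuous).

Use: the continuity input of the cochain calculus `GaloisRepresentations.IsCoboundaryLift.twoCocycleClass_eq` (a `ℤ_p(1)`-valued
correction cochain `h` must be continuous) in the `B_dR⁺`-currency of Kato's reciprocity law (LNM 1553, II Lemma 1.4.3): with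
`ι : ℤ_p(1) → B_dR⁺`, `ε^a ↦ a · t`, continuity of `h` is continuity of `log_ε ∘ h` (`GaloisCohomology.padicLineEquiv`), i.e. of the
coefficient of `t` — this file. BSD / [REC] are not proved here.

## References
* J.-M. Fontaine, *Le corps des périodes p-adiques*, Astérisque 223 (1994), Exp. II §1.5.3–1.5.5. [FontaineAsterisque223III]
* K. Kato, LNM 1553 (1993), Ch. II §1.2.5, Lemma 1.4.3. [Kato1993LNM1553]
-/

noncomputable section

open ValuativeRel Field Ideal WittVector Topology Filter

namespace Literature.NumberTheory.PAdicHodge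

open Literature.NumberTheory.GaloisRepresentations
open Literature.NumberTheory.GaloisRepresentations.IsNonarchimedeanLocalField

namespace GaloisContinuity

variable {F : Type} [Field F] [ValuativeRel F] [TopologicalSpace F] [IsNonarchimedeanLocalField F]
  [CharZero F] {p : ℕ} [Fact p.Prime] [Fact (¬ IsUnit (p : integerC F))]
  [IsAdicComplete (Ideal.span {(p : integerC F)}) (integerC F)]

/-- If `σ ↦ a(σ) · t` is Fontaine-continuous then so is `σ ↦ a(σ) · 1 ∈ B_dR⁺` (division by `t`, `t = ξ · unit`).
[cite: FontaineAsterisque223III, Exp. II §1.5.4–1.5.5] -/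
theorem uc_qpToBdR_coe_of_uc_mul_tBdR (hF : Function.Surjective (fontaineTheta (integerC F) p))
    {a : absoluteGaloisGroup F → ℤ_[p]}
    (ha : ∀ N k : ℕ, ∃ U : OpenSubgroup (absoluteGaloisGroup F), ∀ σ : absoluteGaloisGroup F, ∀ τ ∈ U,
      ∃ (b : Ainf (p := p) F) (w : BDeRhamPlus (integerC F) p),
        qpToBdR ((a (σ * τ) : ℤ_[p]) : ℚ_[p]) * tBdR - qpToBdR ((a σ : ℤ_[p]) : ℚ_[p]) * tBdR =
          ainfToBdR ((p : Ainf (p := p) F) ^ N * b) + xiBdR ^ k * w) :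
    ∀ N k : ℕ, ∃ U : OpenSubgroup (absoluteGaloisGroup F), ∀ σ : absoluteGaloisGroup F, ∀ τ ∈ U,
      ∃ (b : Ainf (p := p) F) (w : BDeRhamPlus (integerC F) p),
        qpToBdR ((a (σ * τ) : ℤ_[p]) : ℚ_[p]) - qpToBdR ((a σ : ℤ_[p]) : ℚ_[p]) =
          ainfToBdR ((p : Ainf (p := p) F) ^ N * b) + xiBdR ^ k * w :=
  uc_of_tBdR_mul hF (w := fun σ => qpToBdR ((a σ : ℤ_[p]) : ℚ_[p]) * tBdR) ha (fun _ => mul_comm _ _)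

/-- ★ **Fontaine-continuity of `σ ↦ a(σ) · t` forces `p`-adic continuity of `a : Γ_F → ℤ_p`.** After division by `t`
the cochain `σ ↦ a(σ)·1` is Fontaine-continuous; its `θ`-projection `σ ↦ a(σ) ∈ ℚ_p ⊆ F ⊆ ℂ_F` satisfies
`‖a(στ) − a(σ)‖_{ℂ_F} ≤ ‖p‖^N` for `τ` in an open subgroup (`θ(Λ(N,1)) ⊆ p^N 𝒪_{ℂ_F}`), and on `ℤ_p` the two absolute values compare
(`‖d‖_{K₀} ≤ ‖p‖_{K₀}^N ↔ |d|_p ≤ p^{−N}`), so `a` is uniformly continuous.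
[cite: FontaineAsterisque223III, Exp. II §1.5.3–1.5.5] [cite: Kato1993LNM1553, Ch. II §1.2.5] -/
theorem continuous_of_uc_qpToBdR_mul_tBdR (hp : valuation F p < 1)
    (hF : Function.Surjective (fontaineTheta (integerC F) p)) {a : absoluteGaloisGroup F → ℤ_[p]}
    (ha : ∀ N k : ℕ, ∃ U : OpenSubgroup (absoluteGaloisGroup F), ∀ σ : absoluteGaloisGroup F, ∀ τ ∈ U,
      ∃ (b : Ainf (p := p) F) (w : BDeRhamPlus (integerC F) p),
        qpToBdR ((a (σ * τ) : ℤ_[p]) : ℚ_[p]) * tBdR - qpToBdR ((a σ : ℤ_[p]) : ℚ_[p]) * tBdR =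
          ainfToBdR ((p : Ainf (p := p) F) ^ N * b) + xiBdR ^ k * w) :
    Continuous a := by
  have hz := uc_qpToBdR_coe_of_uc_mul_tBdR hF ha
  refine continuous_iff_continuousAt.2 fun σ₀ => ?_
  rw [ContinuousAt, Metric.tendsto_nhds]
  intro ε hε
  obtain ⟨N, hN⟩ := PadicInt.exists_pow_neg_lt p hε
  obtain ⟨U, hU⟩ := hz N 1
  have hmem : {σ : absoluteGaloisGroup F | σ₀⁻¹ * σ ∈ (U : Set (absoluteGaloisGroup F))} ∈ 𝓝 σ₀ :=
    (U.isOpen.preimage (continuous_const.mul continuous_id)).mem_nhds (by simp)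
  filter_upwards [hmem] with σ hσ
  obtain ⟨b, w, hbw⟩ := hU σ₀ (σ₀⁻¹ * σ) hσ
  rw [mul_inv_cancel_left, ← map_sub] at hbw
  -- `θ` of the difference is `≤ ‖p‖^N` in `ℂ_F`
  have h1 := norm_thetaBdR_le_of_eq one_ne_zero hbw
  rw [← PadicInt.coe_sub, thetaBdR_qpToBdR hp, CompletedAlgClosure.norm_algebraMap, PadicBase.norm_algebraMap,
    ← PadicBase.ofPadicInt_apply] at h1
  -- `‖p‖_{ℂ_F} = ‖p‖_{K₀}`
  have hpC : ‖(p : CompletedAlgClosure F)‖ = ‖(p : PadicBase F p hp)‖ := by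
    rw [← map_natCast (algebraMap F (CompletedAlgClosure F)), CompletedAlgClosure.norm_algebraMap,
      ← map_natCast (algebraMap (PadicBase F p hp) F), PadicBase.norm_algebraMap]
  rw [hpC, PadicBase.norm_ofPadicInt_le_pow_iff] at h1
  rw [dist_eq_norm]
  exact h1.trans_lt hN

/-- **Conversely, a continuous `a : Γ_F → ℤ_p` gives a Fontaine-continuous cochain `σ ↦ a(σ) · t`** (continuity of the scalar
multiplication `ℚ_p × B_dR⁺ → B_dR⁺` on bounded sets, `uc_qpToBdR_mul`, the constant `t` being bounded).
[cite: Kato1993LNM1553, Ch. II §1.2.5] [cite: FontaineAsterisque223III, Exp. II §1.5.3] -/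
theorem uc_qpToBdR_coe_mul_tBdR_of_continuous {a : absoluteGaloisGroup F → ℤ_[p]} (ha : Continuous a) :
    ∀ N k : ℕ, ∃ U : OpenSubgroup (absoluteGaloisGroup F), ∀ σ : absoluteGaloisGroup F, ∀ τ ∈ U,
      ∃ (b : Ainf (p := p) F) (w : BDeRhamPlus (integerC F) p),
        qpToBdR ((a (σ * τ) : ℤ_[p]) : ℚ_[p]) * tBdR - qpToBdR ((a σ : ℤ_[p]) : ℚ_[p]) * tBdR =
          ainfToBdR ((p : Ainf (p := p) F) ^ N * b) + xiBdR ^ k * w := by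
  have hb : ∀ k : ℕ, ∃ r : ℕ, ∀ _σ : absoluteGaloisGroup F, ∃ (b : Ainf (p := p) F) (w : BDeRhamPlus (integerC F) p),
      (p : BDeRhamPlus (integerC F) p) ^ r * tBdR = ainfToBdR b + xiBdR ^ k * w := fun k => by
    obtain ⟨r, b, w, h⟩ := exists_natCast_pow_mul_eq_ainfToBdR_add (tBdR : BDeRhamPlus (integerC F) p) k
    exact ⟨r, fun _ => ⟨b, w, h⟩⟩
  exact uc_qpToBdR_mul (f := fun σ => ((a σ : ℤ_[p]) : ℚ_[p])) (continuous_subtype_val.comp ha)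
    (y := fun _ => tBdR) (uc_const tBdR) hb

end GaloisContinuity

end Literature.NumberTheory.PAdicHodge

end
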